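import Summits.ResolutionOfSingularities.ResolutionOfSingularities.Theorems.BoundaryLedgerClasses
import Literature.AlgebraicGeometry.Resolution.OrdZeroBasics
import Literature.AlgebraicGeometry.Resolution.AdditiveFormsStructure
import HarnessLib

/-!
# ProximityCut — decomp-res lens-3 («one certified translation + split beneath»), generation 12

[WRITER NOTE (decomp-res writer g5).  The lens file (2197 lines) is filed as route-INDEPENDENT modules sharing the lens
namespace `…Theorems.ProximityCut` (tree convention: files ≤ 400 lines) — THIS file = the lens header (verbatim, below)
+ §1 proximity words (:192–:301) + §2 the pieces (:303–:385); `ProximityCutKernels` = §3; `ProximityCutAxis` = §4;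
`ProximityCutCorner` = §6; `ProximityCutOrigin` = §6b's E-model half (`NoOriginTails`); the pure-integer dynamics of
§6 (ii) / §6b and the whole of §7 (tree leaf `NoCornerTower 4 n`, `HugDimensionClasses.NoCornerTowers` BY NAME) are
`CornerTowerDynamicsTwo` / `CornerTowerDynamicsThree` / `CornerTowerDynamics` (W5, --supports 31569); the by-name
wiring to the route item 31770 (`defectWalksDeep_iff_prox`) is `MaxContactCutProximityCut`; §5 `closes` (ROOT BY NAME
= `MaxContactCutExponentLadder.closes`) is not restated.  REBASE per critic (R1): g11's `NoLoadedCriticalPlateauxDeep`,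
`SatDefectWalksTerminateDeep`, `FreeTailsAreCriticalDeep`, `NoBareTailsDeep`, restated verbatim in the lens (:344–:374),
are the landed `Theorems.BoundaryLedgerClasses` declarations (namespace `BoundaryLedger`, opened) — IMPORTED, not
restated; the lens imports of `MaxContactCutTightDefect` / `MaxContactCutExponentLadder` (Theses cone) are dropped.
VERBATIM otherwise.  Asides booked by the critic for the host route (`PCNoFreePointTailsDeep` [DECIDED desk · NEW LEMMA],
`PCArcLawPort := NoFreePointTails` [prover target L], no new residual aside) are filed by route edit, not here.
No sorry; new Prop pieces `NoFreePointTails(Deep)`, `NoRecurrentProximity(Deep)`, `NoAxisTails`,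
`NoMasslessProximityLineDeep`; support definitions `LeavesNewest`, `StaysOnNewest`.]

RESIDUAL MODE on the live route `MaxContactCut`.  BLOCKER FIRST: the summit-strength open piece this node cuts is
the deep E-format walk class `TightDefectClasses.DefectWalksTerminateDeep` (= `MaxContactCut.DefectWalksDeep`,
item 31770, `MaxContactCutTightDefect.defectWalksDeep_iff : … := Iff.rfl`), below g11's located residual of it
(satellite column ∧ the LOADED critical free plateau line `NoLoadedCriticalPlateauxDeep`).

## The lever: the proximity word of a forced walk and the formal arc through its free points

Move `t+1` of a forced walk `W` (chart `j_{t+1}`, centre `b_{t+1}`, `b_{t+1}(j_{t+1}) = 0`) is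
* NEWEST-FREE (`LeavesNewest W t`): `j_{t+1} = j_t ∨ b_{t+1}(j_t) ≠ 0` — the centre `P_{t+2}` LEAVES the
  exceptional component `E_{t+1} = {u_{j_t} = 0}` created by move `t` (if the chart repeats, the strict transform of
  `E_{t+1}` misses the chart; otherwise its local equation at the new origin is `u_{j_t} + b_{t+1}(j_t)`);
* a PROXIMITY REPEAT (`StaysOnNewest W t`): `j_{t+1} ≠ j_t ∧ b_{t+1}(j_t) = 0` — the centre stays on `E_{t+1}`,
  i.e. `P_{t+2}` is proximate to BOTH `P_{t+1}` and `P_t` (an Enriques satellite of the freshest kind).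
`LeavesNewest W t ↔ ¬ StaysOnNewest W t` (PROVED), so every infinite walk is EVENTUALLY NEWEST-FREE or has
INFINITELY MANY PROXIMITY REPEATS (excluded middle; kernel `eventually_leaves_or_recurrent_stays`).

THE CUT (EXACT, PROVED): `DefectWalksTerminateDeep ⟺ NoFreePointTailsDeep ∧ NoRecurrentProximityDeep`
(`defectDeep_iff_prox`; the all-`e` column `WalksTerminate ⟺ NoFreePointTails ∧ NoRecurrentProximity`,
`walks_iff_prox`), refined along g11's satellite column to the THREE-PIECE CUT `DefectWalksTerminateDeep ⟺
NoFreePointTailsDeep ∧ SatDefectWalksTerminateDeep ∧ NoMasslessProximityLineDeep` (`defectDeep_iff_three`), and —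
since ONE late proximity repeat in an eventually free walk forces g11's critical plateau to be BARE
(`massless_of_rigid_bare`, PROVED from g11's PROVED rigidity `FreeTailsAreCriticalDeep` used by statement) — to the
HEADLINE `defectDeep_iff_four`:  31770 ⟺ ARC LAW [DECIDED, desk] ∧ g11's BARE LINE `NoBareTailsDeep` [KNOWN-MOD-PORT
CJS2020 Cor. 5.37] ∧ g11's SATELLITE COLUMN `SatDefectWalksTerminateDeep` [open].  After g11 + g12 the one open,
un-ported class of the deep E-format column is «infinitely many satellite moves».  Newest-free is WEAKER than
Enriques-free (a walk hugging an OLD component forever while leaving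
each fresh one is newest-free at every move but never free), so `NoFreePointTails` is STRONGER than «no eventually
free tower» and its residual partner is correspondingly SMALLER: only walks whose centre stays on the just-created
divisor infinitely often survive.

## THE ARC LAW (piece `NoFreePointTails`, all `e ≥ 1`, no shade hypothesis) — DESK-PROVED, port-free statement

CLAIM. No forced walk (root `Z^q + F`, `q = p^e`, `K` perfect, isolation of the top locus at every stage) is
newest-free at every move `> N`.
PROOF (classical ingredients only; to be typed as prover target `ArcLawPort`, size L).
(A1) FRAME. Put `u := u_{j_N}` (the exceptional coordinate of move `N`).  By induction on `t > N`, in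
  `𝒪̂_{P_t}` one has `u = ε_t · u^{(t)}_{j_{t-1}}` with `ε_t` a unit: if `j_t = j_{t-1}` the coordinate is unchanged;
  if `j_t ≠ j_{t-1}` then `u^{(t)}_{j_{t-1}} = (u^{(t+1)}_{j_{t-1}} + b_t(j_{t-1})) · u^{(t+1)}_{j_t}` with
  `b_t(j_{t-1}) ≠ 0` (newest-free), a unit multiple of the next exceptional coordinate.
(A2) CHART. The direction of `P_{t+1}` at `P_t` has `du^{(t)}_{j_{t-1}}`-component `1` (if `j_t = j_{t-1}`) or
  `b_t(j_{t-1}) ≠ 0`; as `du = ε_t(P_t) du^{(t)}_{j_{t-1}}` at `P_t`, every centre lies in the `u`-chart of the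
  blow-up written in ANY regular frame `(y^{(t)}, u)` at `P_t` (`y^{(t)}` = three coordinates: `Z_t` and two `u`'s
  at `t = N`), and `P_{t+1} = (y^{(t)}/u = a^{(t+1)}, u = 0)` with `a^{(t+1)} ∈ K^3` (centres are `K`-rational).
  Set `y^{(t+1)} := y^{(t)}/u − a^{(t+1)}`.
(A3) ARC. `y^{(N+n)} = (y − Σ_{k=1}^{n} a^{(k)} u^k)/u^n`.  With `φ(u) := Σ_{k ≥ 1} a^{(k)} u^k ∈ K[[u]]^3` and
  `y* := y − φ(u)`, `(y*, u)` is a regular system of parameters of `𝒪̂_{P_N} = K[[y*, u]]`, `Γ := V(y*)` is a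
  SMOOTH FORMAL ARC through `P_N` (the Enriques–Chisini branch of the free points), and `P_{N+n} = V(y*/u^n, u)`.
(A4) ORDER ALONG Γ. Expand `f_N = Z_N^q + F_N = Σ_{α ∈ ℕ^3, k} c_{α,k} y*^α u^k`.  The multiplicity is EXACTLY `q`
  at every centre (`f_t = Z_t^q + F_t`, `ord F_t ≥ q` by equimultiplicity + cleaning, tree `walk_ord`), so the
  strict transform is the total transform divided by `u^q` at each step and, in the frame `(y_n := y*/u^n, u)` at
  `P_{N+n}`, `f_{N+n} = Σ c_{α,k} y_n^α u^{k + n(|α| − q)}` with distinct exponents for distinct `(α, k)`.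
  `ord_{P_{N+n}} f_{N+n} ≥ q` for ALL `n` gives `|α| + k + n(|α| − q) ≥ q` for all `n` whenever `c_{α,k} ≠ 0`,
  hence `|α| ≥ q` for every monomial: `f_N ∈ 𝔭_Γ^q`, `𝔭_Γ = (y*_0, y*_1, y*_2)`.
(A5) DOWN TO THE BASE. Apply the continuous `K[[u_1,u_2,u_3]]`-algebra map `Z_N ↦ φ_0(u)`: it sends `𝔭_Γ` onto
  `𝔭̄ := (u_i − φ_i(u), u_{i'} − φ_{i'}(u))` (the base arc `Γ̄`, `{i, i', j_N} = Fin 3`) and `f_N` to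
  `φ_0(u)^q + F_N`, so `F_N ∈ −φ_0(u)^q + 𝔭̄^q`.  For a Hasse derivative `∂^{(d)}`, `0 < |d| < q`:
  `∂^{(d)}(φ_0(u)^q) = 0` (`φ_0^q ∈ K[[u^q]]` and `p ∣ C(qn, d_j)` for `0 < d_j < q = p^e`), and
  `∂^{(d)}(𝔭̄^q) ⊆ 𝔭̄` (higher Leibniz rule `∂^{(d)}(g_1⋯g_q) = Σ_{d_1+…+d_q=d} ∏ ∂^{(d_i)}
g_i`: with `|d| < q`
  some `d_i = 0`, so one factor `g_i ∈ 𝔭̄` survives underived; tree `hasseDeriv_mul`).  Hence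
  `topIdeal q F_N · K[[u]] ⊆ 𝔭̄` (the tree's `topIdeal` is generated by exactly these `∂^{(d)} F_N`).
(A6) ISOLATION. `IsolatedTop q F_N` gives `g · u_{j_N}^{N₀} ∈ topIdeal q F_N ⊆ 𝔭̄` with `g(0) ≠ 0`;
`𝔭̄` is prime
  and `u = u_{j_N} ∉ 𝔭̄` (`K[[u_1,u_2,u_3]]/𝔭̄ ≅ K[[u]]`, `u ↦ u`), so `g ∈ 𝔭̄`, i.e.
`g(φ_i(u), φ_{i'}(u), u) = 0`
  in `K[[u]]`; setting `u = 0` (`φ(0) = 0`) gives `g(0) = 0` — contradiction. ∎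
Sources: free/satellite infinitely near points and smooth branches [CasasAlvero2000 §3.5–3.6, Prop. 3.6.2,
Thm. 3.5.3 — corpus:book:casas-alvero2000 p.136–142, p.168]; Hasse–Schmidt order criterion / `Diff`-description of
the top multiplicity locus over perfect fields [Villamayor2008 §2.6, §4.1; BenitoVillamayor2013 §1.13–1.17 — the
tree's `topIdeal` docstring; tree `HasseSchmidtDerivatives.hasseDeriv_mul`, `AdditiveFormsStructure.coeff_hasseDeriv`];
model semantics = Hauser2010 §§D–F (tree `TowerDictionary`).  presearch: «infinitely near points along a smooth
branch, multiplicity of strict transforms» → [corpus:book:casas-alvero2000 p0141–p0142 (§3.6, Prop. 3.6.2)], plane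
case only; dim-4 formal version = (A1)–(A6) here; galaxy «infinitely near points|quadratic transform along|proximate
points» → 0 relevant hits (noise).

THE AXIS LAW (sub-piece `NoAxisTails`: no tail sits at the ORIGIN of one FIXED chart forever — the arc is the
`u_j`-axis) is the in-model shadow of (A4)–(A6) with no power series.  PRIORITY NOTE (bus): lens-5 g13 `LassoCut`
(STATUS NODE 10:54:58Z, critic row 78) PROVED the same statement `LassoCut.no_axis_tail` one minute before this file
first compiled (10:56Z) — the decided axis CELL is lens-5's credit; §4 below is an INDEPENDENT simultaneous proof
(different bookkeeping: induction on the `u_j`-exponent, restriction map `aeval (axisMap K j)` instead of the axis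
ideal), kept as a cross-check and to be replaced by an `import` of the writer-filed lens-5 module on rebase.  What is
THIS node's own: the proximity word, the ARC LAW (A1)–(A6) deciding the far larger newest-free class, the closure of
g11's loaded line, the three-piece cut and the massless-line law.  The Lean proof (`noAxisTails_holds`, §4:
monomial descent `d_j ↦ d_j − (q − α)` per step, `α` = off-`j` degree — a thin monomial (`α < q`) is never deleted
(not a `q`-th power, by cleanliness when `α = 0`) and never collides (`chartExponent_injOn`), so it would reach total
degree `< q`, contradicting equimultiplicity; hence every monomial is FAT, the substitution `u_i, u_{i'} ↦ 0` kills
every `∂^{(d)} F_N`, `|d| < q` (`coeff_hasseDeriv`), and isolation forces `g(0) = 0`).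
NEXT RUNG FOR PROVERS (blueprint, in-model, no power series — `NoOneChartTails`: constant chart `j`, arbitrary
centres): (B1) conjugation `τ_c ∘ χ = χ ∘ T_{c,1}`, `T_{c,k} ∘ χ = χ ∘ T_{c,k+1}` (`χ` = chart `j`, `τ_c` =
translation, `T_{c,k} : u_i ↦ u_i + c_i u_j^k`), so WITHOUT cleaning `G_n = χ^n(Θ_n F_N)`, `Θ_n` = translation by
the truncated arc `φ^{(n)}_i = Σ_{k ≤ n} b^{(k)}_i u_j^k`; (B2) cleaning is harmless: `𝒫 := K[u_1^q,u_2^q,u_3^q]` is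
stable under `χ, τ, T` and `F_{N+n} = clean(G_n)` (induction, `clean(τχ clean G) = clean(τχ G)`); (B3) monomial
descent in the `Θ_n`-frame exactly as in §4 gives: the thin part of `Θ_n F_N` is divisible by `u_j^{M_n}`,
`M_n → ∞`; (B4) `Diff^{<q}` is frame-independent (`taylor`: `(θF)(u+v) = F(θu + v')` with `v ↦ v'` unipotent), so
`topIdeal q F_N ⊆ 𝔭_n + (u_j^{M_n − q})`, `𝔭_n = (u_i − φ^{(n)}_i)`; (B5) restrict `g u_j^{N₀} ∈
topIdeal` to the
truncated arc: `u_j`-order `N₀ < M_n − q` for `n ≫ 0` — contradiction.  (Chart-changing newest-free tails need the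
unit factors of (A1); that is the power-series port `ArcLawPort`.)

## Pieces and tags (blocker `DefectWalksTerminateDeep` = 31770 by name; critic scoring conventions of rows 52–74)
* `NoFreePointTailsDeep` — NECESSARY (instantiation) · WEAKER (decided!) · DECIDED by the ARC LAW (A1)–(A6)
  (all `e`, all `p`, perfect `K`; statement-level port `ArcLawPort := NoFreePointTails`, prover target, size L:
  formal blow-up frames + `hasseDeriv_mul`; its AXIS case `NoAxisTails` PROVED here).  CONTAINS (PROVED
  `loaded_of_freeTails`): g11's located thin line `NoLoadedCriticalPlateauxDeep` — in a loaded free plateau the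
  boundary is the single fresh component of mass `ρ ≥ 1`, so a proximity repeat would be a (ledger-)satellite move.
  Contains too: every FREE LOADED tail (the census's long sub-critical «hugging one component» plateaux, T-tight-1
  v2; PROVED `leavesNewest_of_free_loaded`), every constant-chart tail (`leavesNewest_of_chart_eq`), every
  eventually Enriques-free tail, every tail hugging old components that leaves each fresh one.
* `NoRecurrentProximityDeep` — THE RESIDUAL · NECESSARY · UNDECIDED · score 0 honestly · IDEA-NEEDED ·
  INSTRUMENTABLE (census ask T-prox: proximity words).  Structure (PROVED): at a repeat the fresh component `j_t` is
  KEPT with its mass `o_t − q` (`r_succ_succ_of_stays`), so a repeat after a state of order `> q` is a satellite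
  move (`satellite_of_stays_loaded`) and every other repeat is MASSLESS, following a state of the minimal order `q`
  (`order_eq_of_stays_not_satellite`); `≡ 31770` given the arc law (`defectDeep_iff_prox`).  This is where the
  `p`-cyclic satellite recurrence lives (lens-6's pointwise-infinite pattern `∂_w, ∂_x, ∂_w, …` at the origin: every
  move a proximity repeat) — the E-model face of the tower side's located residual 31261 `NoCoreValuativeTowers`.
* `NoMasslessProximityLineDeep` — THE LOCATED SUB-RESIDUAL outside g11's satellite column (EXACT three-piece cut
  `defectDeep_iff_three`) · NECESSARY · UNDECIDED · IDEA-NEEDED · INSTRUMENTABLE: finitely many satellite moves yet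
  infinitely many proximity repeats, each right after a minimal-order state (`massless_line_law`, PROVED).
* `SatDefectWalksTerminateDeep` — g11's satellite column restated VERBATIM (g11 §4 / tree `SatDefectWalksTerminate`
  at `2 ≤ e`) · NECESSARY · UNDECIDED · THE LOCATED RESIDUAL of the whole deep column after `defectDeep_iff_four`
  (g11: where jumps and the `p`-cyclic recurrence live) · IDEA-NEEDED · INSTRUMENTABLE (T-sat, T-prox).
* `NoBareTailsDeep`, `FreeTailsAreCriticalDeep` — g11 §4 restated VERBATIM: the bare critical line [KNOWN-MOD-PORT
  `BareTailPort`, CJS2020 Cor. 5.37 / Thm. 9.2, as booked by g11 and critic row 73] and g11's PROVED rigidity cell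
  [used BY STATEMENT as the hypothesis of `massless_of_rigid_bare` / `defectDeep_iff_four`; proof in g11's file].
* `NoAxisTails` — PROVED IN LEAN (§4, any prime power `q`; the proof uses neither `CharP` nor perfectness) —
  SIMULTANEOUS with and SECOND to lens-5 g13 `LassoCut.no_axis_tail` (same statement; credit theirs; no claim here
  beyond the cross-check); `noAxisTails_deep` instantiates it on the defect column.
* `NoCornerHuggingTails` — PROVED IN LEAN (§6, ADDENDUM after critic row 79; any prime power `q`, port-free, no
  shade hypothesis): no tail sits from some stage on at the ORIGIN of charts avoiding one fixed coordinate `k` (the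
  walk never hugs an old component `{u_k = 0}` through corner points forever).  Contains the axis law; its half
  «both charts off `k` recur» is the FIRST PORT-FREE DECIDED PIECE INSIDE THE RESIDUAL `NoRecurrentProximity(Deep)`
  (every chart change at the origin is a proximity repeat).  Mechanism: EUCLID DYNAMICS `L/R` of the off-chart
  defects `(y_{i'}, y_i)` along monomial lineages (`no_doubly_thin`, `dyn_exit`) + pigeonhole over the support of
  `F_N` + the §4 endgame; `noCornerHuggingTails_deep` instantiates it on the defect column.
* `noCornerTower_two`, `noCornerTower_three` — PROVED IN LEAN (§7, ADDENDUM): the tree's combinatorial leaf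
  `MonomialTowerClasses.NoCornerTower d n` for `d = 2, 3` and ALL `n` (cheap theorem #17′ of critic row 58, booked on
  31569 «KNOWN mod CornerModel + TowerObstructs; ATTACKABLE directly; d ≤ 1 proved»), by the same dynamics in lens-4's
  corner-tower model; lens-4's `NoCornerTowers` (`d ≤ 4`) is thereby reduced, port-free, to `d = 4` with ≥ 3
  recurring live directions.
* `NoOriginTails` — PROVED IN LEAN (§6b, ADDENDUM rev 3; any prime power `q`, port-free, no shade hypothesis): no
  tail sits at the ORIGIN of its charts from some stage on (`b_t = 0` for `t ≥ N`), WHATEVER THE CHARTS — strictly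
  contains the corner-hugging law and the axis law; the new case «all three charts recur» is a second decided piece
  INSIDE the proximity residual, whose open content is now «infinitely many proximity repeats with infinitely many
  TRANSLATED centres `b_t ≠ 0`».  Mechanism: the THREE-LETTER dynamics `y_x += y_j (x ≠ j)` with the `ℓ¹`-norm as
  Lyapunov function (`dyn3_eventually`: never triply negative + all letters recurring ⇒ eventually `y ≥ 0`), fed by
  `no_triply_thin`; `noOriginTails_deep` instantiates it on the defect column.
* `noCornerTower_four`, `noCornerTowers_holds`, `noCornerTowers_tree : HugDimensionClasses.NoCornerTowers` — PROVED
  IN LEAN (§7, rev 3): lens-4's piece `NoCornerTowers` (all corner towers in `d ≤ 4` parameters terminate; booked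
  KNOWN-MOD-PORT via `CornerModel` + `TowerObstructs`) is now a THEOREM BY NAME, port-free (`d = 4`: a dead
  direction `k`, live directions `k.succAbove z`; constant ⇒ axis descent, a second dead one ⇒ `not_two_live`, else
  `not_three_live` by the three-letter dynamics).
* g11's `NoLoadedCriticalPlateauxDeep` restated VERBATIM (g11 §4; delete on rebase once `BoundaryLedgerClasses`
  lands) only to PROVE the inclusion `loaded_of_freeTails`.

WHY EACH OPEN PIECE IS STRICTLY WEAKER THAN THE BLOCKER: `NoFreePointTailsDeep` is decided (desk) while 31770 is
open; `NoRecurrentProximityDeep` omits every eventually-newest-free walk — a class the blocker must kill and which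
is killed here by a separate theorem, not by rewording (probes `bc/Probe.lean`: neither piece gives the blocker by
`exact?/simpa/aesop`; BC2-style).
WHY NOVEL (relative to the tree and the bus): the tower side's leaf 31258 `NoEventuallyFreeTowers` (lens-4 g8) is
decided over perfect fields through TWO heavy ports (Giraud's `Diff`-telescoping `TowerDivergence` 31262 + the
proximity law); hugging tails go through the hugged-germ classification (31259 τ ≥ 2, 31260 UNDECIDED, g11
`SurfaceLaw`).  The arc law decides the LARGER class «eventually newest-free» by ONE elementary mechanism (the
Enriques–Chisini formal branch of the free points + `∂^{(d)}(𝔭^q) ⊆ 𝔭` for `|d| < q`), typed IN THE MODEL where the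
isolation hypothesis is already a Hasse-ideal membership (so no `Diff`-sheaf formalisation is needed), with its
axis case machine-checked; and it closes g11's loaded line, which no tower-side leaf names.  Transverse to g11
(free/satellite by MASS) and to g10/N52 (jumps): a proximity repeat may be massless, a ledger-satellite move may be
newest-free.
BARRIERS: `Literature.Barriers` has no ResolutionOfSingularities catalogue in the tree; technique class = infinitely
near points / formal arcs / Hasse–Schmidt order criterion (characteristic-free; no Bernstein–Sato, no hypersurface of
maximal contact is used — the known positive-characteristic obstructions (failure of maximal contact, kangaroo
points) concern the RESIDUAL, not the arc law).  Negatives index (`ledger negatives`): no statement about forced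
walks / free points is refuted.
-/

open MvPolynomial
open Literature.AlgebraicGeometry.Resolution
open Literature.AlgebraicGeometry.Resolution.Hauser2010
open Literature.AlgebraicGeometry.Resolution.PointBlowup
open Summit.ResolutionOfSingularities.ResolutionOfSingularities.Theorems.TightDefectClasses
open Summit.ResolutionOfSingularities.ResolutionOfSingularities.Theorems.TightDefectStrongWalks
open Summit.ResolutionOfSingularities.ResolutionOfSingularities.Theorems.ItineraryCutClasses
open Summit.ResolutionOfSingularities.ResolutionOfSingularities.Theorems.BoundaryLedger

namespace Summit.ResolutionOfSingularities.ResolutionOfSingularities.Theorems.ProximityCut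

/-! ## §1 Proximity words of a forced walk (definitions + PROVED bookkeeping) -/

section Walk

variable {K : Type} [Field K] [DecidableEq K] {q : ℕ} {s₀ : State (Fin 3) K}

/-- Move `t+1` is NEWEST-FREE: its centre leaves the exceptional component created by move `t` (chart repeat, or
non-zero `u_{j_t}`-coordinate).  DEFINITION (new typed object: the letter `F` of the proximity word). -/
def LeavesNewest (W : ForcedWalk q s₀) (t : ℕ) : Prop :=
  W.j (t + 1) = W.j t ∨ W.b (t + 1) (W.j t) ≠ 0

/-- Move `t+1` is a PROXIMITY REPEAT: the chart changes and the centre stays on the component created by move `t`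
(the next point is proximate to the two preceding ones).  DEFINITION (the letter `S` of the proximity word). -/
def StaysOnNewest (W : ForcedWalk q s₀) (t : ℕ) : Prop :=
  W.j (t + 1) ≠ W.j t ∧ W.b (t + 1) (W.j t) = 0

/-- The two letters are complementary (PROVED). [folklore] -/
theorem leavesNewest_iff_not_stays (W : ForcedWalk q s₀) (t : ℕ) : LeavesNewest W t ↔ ¬ StaysOnNewest W t := by
  unfold LeavesNewest StaysOnNewest
  tauto

/-- THE DICHOTOMY OF INFINITE PROXIMITY WORDS (PROVED, excluded middle): eventually all `F`, or `S` recurs. [folklore] -/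
theorem eventually_leaves_or_recurrent_stays (W : ForcedWalk q s₀) :
    (∃ N, ∀ t, N ≤ t → LeavesNewest W t) ∨ (∀ N, ∃ t, N ≤ t ∧ StaysOnNewest W t) := by
  by_cases h : ∀ N, ∃ t, N ≤ t ∧ StaysOnNewest W t
  · exact Or.inr h
  · left
    push Not at h
    obtain ⟨N, hN⟩ := h
    exact ⟨N, fun t ht => (leavesNewest_iff_not_stays W t).mpr (hN t ht)⟩

/-- Off the chart variable the new multiplicity is the old one if the centre lies on that component, else `0`
(PROVED; the model's `newMult`). [folklore] (Sources: Hauser2010 §D.) -/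
theorem r_succ_apply_of_ne (W : ForcedWalk q s₀) (t : ℕ) {i : Fin 3} (hi : i ≠ W.j t) :
    (W.st (t + 1)).r i = if W.b t i = 0 then (W.st t).r i else 0 := by
  classical
  rw [W.st_succ]
  show (newMult q (W.j t) (W.b t) (W.st t)) i = _
  unfold newMult
  rw [Finsupp.coe_update, Function.update_of_ne hi, Finsupp.filter_apply]

/-- After a move that is not a (ledger-)satellite move, the boundary sits on the fresh component only (PROVED).
[folklore] -/
theorem r_succ_eq_zero_of_not_satellite (W : ForcedWalk q s₀) (t : ℕ) (hfree : ¬ W.Satellite t) {i : Fin 3}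
    (hi : i ≠ W.j t) : (W.st (t + 1)).r i = 0 := by
  rw [r_succ_apply_of_ne W t hi]
  by_cases hb : W.b t i = 0
  · rw [if_pos hb]
    by_contra hr
    exact hfree ⟨i, hi, hb, Nat.pos_of_ne_zero hr⟩
  · rw [if_neg hb]

/-- … so its total mass is the fresh mass (PROVED). [folklore] -/
theorem degree_r_succ_of_not_satellite (W : ForcedWalk q s₀) (t : ℕ) (hfree : ¬ W.Satellite t) :
    (W.st (t + 1)).r.degree = (W.st (t + 1)).r (W.j t) := by
  classical
  have hsingle : (W.st (t + 1)).r = Finsupp.single (W.j t) ((W.st (t + 1)).r (W.j t)) := by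
    ext i
    by_cases hi : i = W.j t
    · rw [hi, Finsupp.single_eq_same]
    · rw [Finsupp.single_apply, if_neg (fun h => hi h.symm), r_succ_eq_zero_of_not_satellite W t hfree hi]
  conv_lhs => rw [hsingle]
  rw [Finsupp.degree_single]

/-- At a PROXIMITY REPEAT the fresh component of move `t` is KEPT with its mass (PROVED; structure of the residual:
repeats after a move of order `> q` are ledger-satellite moves, repeats after a move of order `q` are massless). [folklore] -/
theorem r_succ_succ_of_stays (W : ForcedWalk q s₀) (t : ℕ) (hS : StaysOnNewest W t) :
    (W.st (t + 2)).r (W.j t) = (W.st (t + 1)).r (W.j t) := by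
  rw [show t + 2 = (t + 1) + 1 from rfl, r_succ_apply_of_ne W (t + 1) (Ne.symm hS.1), if_pos hS.2]

/-- KEY INCLUSION LEMMA (PROVED): two consecutive non-satellite moves with a loaded boundary in between force the
second move to be newest-free (else the fresh component of mass `≥ 1` would be kept: a satellite move). [folklore] -/
theorem leavesNewest_of_free_loaded (W : ForcedWalk q s₀) (t : ℕ) (hf : ¬ W.Satellite t)
    (hf' : ¬ W.Satellite (t + 1)) (hρ : 1 ≤ (W.st (t + 1)).r.degree) : LeavesNewest W t := by
  rw [leavesNewest_iff_not_stays]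
  intro hS
  rw [degree_r_succ_of_not_satellite W t hf] at hρ
  exact hf' ⟨W.j t, Ne.symm hS.1, hS.2, hρ⟩

/-- STRUCTURE OF THE RESIDUAL (PROVED): a proximity repeat right after a move from a state of order `> q` keeps a
component of POSITIVE mass — it is a (ledger-)satellite move. [folklore] -/
theorem satellite_of_stays_loaded (W : ForcedWalk q s₀) (t : ℕ) (hS : StaysOnNewest W t) {o : ℕ}
    (ho : ordZero (W.st t).F = o) (hqo : q < o) : W.Satellite (t + 1) := by
  classical
  -- [WRITER NOTE] the lens lemma `r_succ_self` (= the landed `NoJump.r_succ_chart`, in the MaxContactCut cone) is inlined here to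
  -- keep this module route-independent (gate dedup.landed on the first submission).
  have r_succ_self : (W.st (t + 1)).r (W.j t) = o - q := by
    rw [W.st_succ]
    show (newMult q (W.j t) (W.b t) (W.st t)) (W.j t) = _
    unfold newMult
    rw [Finsupp.coe_update, Function.update_self, ho]
    rfl
  exact ⟨W.j t, Ne.symm hS.1, hS.2, by rw [r_succ_self]; omega⟩

/-- … hence a proximity repeat which is NOT a satellite move is MASSLESS: it follows a move from a state of the
minimal order `q` (PROVED; `o_t ≥ q` along walks from a root, tree `walk_nat`). [folklore] -/
theorem order_eq_of_stays_not_satellite (hs : IsRoot q s₀) (W : ForcedWalk q s₀) (t : ℕ) (hS : StaysOnNewest W t)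
    (hf : ¬ W.Satellite (t + 1)) : ordZero (W.st t).F = (q : ℕ∞) := by
  obtain ⟨o, ho, hqo⟩ := walk_nat hs W t
  rcases Nat.lt_or_ge q o with hlt | hge
  · exact absurd (satellite_of_stays_loaded W t hS ho hlt) hf
  · rw [ho]
    exact_mod_cast le_antisymm hge hqo

/-- A constant-chart tail is newest-free (PROVED; the axis case sits inside the arc law's class). [folklore] -/
theorem leavesNewest_of_chart_eq (W : ForcedWalk q s₀) (t : ℕ) (h : W.j (t + 1) = W.j t) : LeavesNewest W t :=
  Or.inl h

end Walk

/-! ## §2 The pieces (typed over the tree's classes; blocker `DefectWalksTerminateDeep` BY NAME) -/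

/-- PIECE · THE ARC LAW (all `e ≥ 1`, no shade hypothesis) · DECIDED (desk proof (A1)–(A6) of the module docstring;
statement-level port = this very Prop as prover target `ArcLawPort`, size L) · WEAKER than `WalksTerminate`:
no forced walk from a root is newest-free at every move beyond some stage. -/
def NoFreePointTails : Prop :=
  ∀ p : ℕ, p.Prime → ∀ e : ℕ, 1 ≤ e → ∀ (K : Type) [Field K] [CharP K p] [PerfectField K] [DecidableEq K]
    (s₀ : State (Fin 3) K), IsRoot (p ^ e) s₀ → ∀ W : ForcedWalk (p ^ e) s₀,
    ∀ N : ℕ, (∀ t, N ≤ t → LeavesNewest W t) → False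

/-- PIECE · the arc law on the deep defect column (instance of `NoFreePointTails`, kernel `freeTailsDeep_of_all`) ·
NECESSARY for the blocker (`freeTailsDeep_of_defect`) · DECIDED (desk) · CONTAINS g11's loaded line
(`loaded_of_freeTails`, PROVED). -/
def NoFreePointTailsDeep : Prop :=
  ∀ p : ℕ, p.Prime → ∀ e : ℕ, 2 ≤ e → ∀ (K : Type) [Field K] [CharP K p] [PerfectField K] [DecidableEq K]
    (s₀ : State (Fin 3) K), IsRoot (p ^ e) s₀ → ∀ W : ForcedWalk (p ^ e) s₀, (∀ i, 1 ≤ (W.st i).shade) →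
    ∀ N : ℕ, (∀ t, N ≤ t → LeavesNewest W t) → False

/-- PIECE · THE RESIDUAL of 31770 after the arc law · NECESSARY (`recurrentDeep_of_defect`) · UNDECIDED · score 0 ·
IDEA-NEEDED · INSTRUMENTABLE (T-prox): no infinite deep defect walk makes infinitely many PROXIMITY REPEATS
(centre on the just-created divisor while the chart changes).  `≡ 31770` modulo the decided arc law
(`defectDeep_iff_prox`). -/
def NoRecurrentProximityDeep : Prop :=
  ∀ p : ℕ, p.Prime → ∀ e : ℕ, 2 ≤ e → ∀ (K : Type) [Field K] [CharP K p] [PerfectField K] [DecidableEq K]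
    (s₀ : State (Fin 3) K), IsRoot (p ^ e) s₀ → ∀ W : ForcedWalk (p ^ e) s₀, (∀ i, 1 ≤ (W.st i).shade) →
    (∀ N : ℕ, ∃ t, N ≤ t ∧ StaysOnNewest W t) → False

/-- PIECE · the all-`e` residual of the tree's `WalksTerminate` (column 30253 via `TowerRealisation`) after the arc
law · UNDECIDED · score 0. -/
def NoRecurrentProximity : Prop :=
  ∀ p : ℕ, p.Prime → ∀ e : ℕ, 1 ≤ e → ∀ (K : Type) [Field K] [CharP K p] [PerfectField K] [DecidableEq K]
    (s₀ : State (Fin 3) K), IsRoot (p ^ e) s₀ → ∀ W : ForcedWalk (p ^ e) s₀,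
    (∀ N : ℕ, ∃ t, N ≤ t ∧ StaysOnNewest W t) → False

/-- SUB-PIECE · THE AXIS LAW · PROVED IN LEAN (`noAxisTails_holds`, §4): no forced walk from a root sits, from some
stage on, at the ORIGIN of one FIXED chart (`j_t = j`, `b_t = 0`): the arc law's case «Γ = the `u_j`-axis». -/
def NoAxisTails : Prop :=
  ∀ p : ℕ, p.Prime → ∀ e : ℕ, 1 ≤ e → ∀ (K : Type) [Field K] [CharP K p] [PerfectField K] [DecidableEq K]
    (s₀ : State (Fin 3) K), IsRoot (p ^ e) s₀ → ∀ W : ForcedWalk (p ^ e) s₀,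
    ∀ (N : ℕ) (j : Fin 3), (∀ t, N ≤ t → W.j t = j ∧ W.b t = 0) → False

/-! g11's `NoLoadedCriticalPlateauxDeep`, `SatDefectWalksTerminateDeep`, `FreeTailsAreCriticalDeep`, `NoBareTailsDeep`
(lens :344–:374, restated there verbatim «delete on rebase») are the landed `BoundaryLedger.*` declarations — imported. -/

/-- PIECE · THE MASSLESS PROXIMITY LINE — the located residual of 31770 OUTSIDE g11's satellite column (EXACT cut
`defectDeep_iff_three`) · NECESSARY · UNDECIDED · score 0 · IDEA-NEEDED · INSTRUMENTABLE (T-prox): no infinite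
deep defect walk with only finitely many satellite moves makes infinitely many proximity repeats.  By
`order_eq_of_stays_not_satellite` every late repeat of such a walk is MASSLESS — it follows a move from a state of
the MINIMAL order `q` (`shade + |r| = q`: a critical bare state `r = 0`, or a sub-critical loaded one). -/
def NoMasslessProximityLineDeep : Prop :=
  ∀ p : ℕ, p.Prime → ∀ e : ℕ, 2 ≤ e → ∀ (K : Type) [Field K] [CharP K p] [PerfectField K] [DecidableEq K]
    (s₀ : State (Fin 3) K), IsRoot (p ^ e) s₀ → ∀ W : ForcedWalk (p ^ e) s₀, (∀ i, 1 ≤ (W.st i).shade) →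
    (∃ N : ℕ, ∀ t, N ≤ t → ¬ W.Satellite t) → (∀ N : ℕ, ∃ t, N ≤ t ∧ StaysOnNewest W t) → False

end Summit.ResolutionOfSingularities.ResolutionOfSingularities.Theorems.ProximityCut
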